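import Literature.Geometry.Symplectic.PencilEndLeafFloc
import Literature.Geometry.Symplectic.PencilEndMemberFraming
import Literature.Geometry.Symplectic.JSphereLocalFoliation
import Literature.Geometry.Symplectic.JPlanePencilLocalFamilyReduction
import HarnessLib

/-!
# Wendl's Prop. 2.53 (`m = 1`, homotopy 4-spheres) from the local foliation by `J`-spheres

Support theorem (no new facts, D-0026) for
`Literature.Geometry.Symplectic.jPlanePencil_localFamily_homotopySphere`
(`JPlanePencilLocalFamily.lean`; C. Wendl, *Holomorphic Curves in Low Dimensions* (2018),
Prop. 2.53 with `m = 1`).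

`jPlanePencil_localFamily_homotopySphere_of_hls`: the fact follows from the named fact
`hls_localFoliation_embeddedSphere_trivialNormal` (`JSphereLocalFoliation.lean`: the local
`2`-parameter family of embedded `J`-spheres through an embedded `J`-sphere with trivial normal
bundle in an almost complex `4`-manifold — Wendl Prop. 2.53 with `m = 0` / Hofer–Lizan–Sikorav),
exactly as in Wendl's printed proof of the case `m = 1` (p. 65): blow up the end at the constraint
point — the blown-up partial end-compactification `Y = (M ∖ p) ∪ Ω` with its almost complex
structure `JY` (`PencilEndGluing.lean`, `PencilEndAlmostComplex.lean`); the member `u₀` closes up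
to an embedded `JY`-sphere `(memberU u₀, memberV u₀ b₀)` of `Y` (`PencilEndMemberSphere.lean`)
with trivial normal bundle (`PencilEnd.exists_trivialNormal_memberGlue`,
`PencilEndMemberFraming.lean`: a normal framing transported from `M ≃ S⁴` and glued to the far
frame); the HLS fact gives the local family of leaves; the leaves minus their (unique, transverse)
points on the exceptional sphere, renormalised, are the members `Floc b` of the nearby intercepts,
jointly smooth and immersive, with a uniform standard end and smooth blow-up coordinates
(`PencilEnd.exists_leafFloc`, `PencilEndLeafFloc.lean`); and the reduction
`jPlanePencil_localFamily_homotopySphere_of_compactifiedFamily`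
(`JPlanePencilLocalFamilyReduction.lean`: universality by positivity of intersections and
`H₂(M) = 0`) concludes.

## References

* C. Wendl, *Holomorphic Curves in Low Dimensions*, LNM 2216, Springer (2018), Prop. 2.53,
  Thm. 2.49, Thm. 2.46. [Wendl2018]
* H. Hofer, V. Lizan, J.-C. Sikorav, On genericity for holomorphic curves in four-dimensional
  almost-complex manifolds, J. Geom. Anal. 7 (1997) 149–159, Thm. 1. [HoferLizanSikorav1997]
-/

noncomputable section

open scoped Manifold ContDiff Topology
open Set Function Filter Metric

namespace Literature.Geometry.Symplectic

/-- **Wendl's Prop. 2.53 (`m = 1`, homotopy 4-spheres) from the local-foliation fact** (see the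
module docstring). [cite: Wendl2018, Prop. 2.53 (proof, p. 65)] -/
theorem jPlanePencil_localFamily_homotopySphere_of_hls
    (hHLS : hls_localFoliation_embeddedSphere_trivialNormal) :
    jPlanePencil_localFamily_homotopySphere := by
  refine jPlanePencil_localFamily_homotopySphere_of_compactifiedFamily ?_
  intro M _ _ _ _ _ _ hM p J ε' hε' hεt hJ2 hJs hJstd u₀ b₀ hu₀
  -- the blown-up end at `p`, with box `Ω = B_{ε'}(0) × B_1(b₀)`
  let G : PencilEnd p :=
    { rad := ε', b₀ := b₀, ρ := ε', ρ' := 1, rad_pos := hε', ρ_pos := hε', ρ_le := le_rfl,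
      ρ'_pos := one_pos, closedBall_subset := hεt }
  have hb₀ : ‖b₀ - G.b₀‖ < G.ρ' := by
    show ‖b₀ - b₀‖ < 1
    rw [sub_self, norm_zero]; exact one_pos
  have hJstd' : ∀ x : punctured p, InPuncturedChartBall p G.rad x →
      ∀ (v : TangentSpace (𝓡 4) x) (c : EuclideanSpace ℝ (Fin 4)),
        inner ℝ (fderiv ℝ inversion (extChartAt (𝓡 4) p x.1 - extChartAt (𝓡 4) p p)
          (mfderiv (𝓡 4) 𝓘(ℝ, EuclideanSpace ℝ (Fin 4))
            (fun z : punctured p => extChartAt (𝓡 4) p z.1) x (J x v))) c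
        = stdSymplecticForm (fderiv ℝ inversion (extChartAt (𝓡 4) p x.1 - extChartAt (𝓡 4) p p)
          (mfderiv (𝓡 4) 𝓘(ℝ, EuclideanSpace ℝ (Fin 4))
            (fun z : punctured p => extChartAt (𝓡 4) p z.1) x v)) c := hJstd
  -- the compactified member has trivial normal bundle in `Y` (Stage C)
  obtain ⟨Nset, π, hNo, hNsub, hπs, hπsurj, hzero⟩ :=
    G.exists_trivialNormal_memberGlue hM hu₀ hb₀ hJstd'
  -- the local foliation of `Y` by embedded `JY`-spheres through the compactified member (HLS)
  obtain ⟨ε, U, V, hε, hU0, hV0, hleaf, hUfam, hVfam, -, hinj, -, -⟩ :=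
    hHLS G.Y (G.acsY J hJ2 hJs hJstd') (G.memberU u₀) (G.memberV u₀ b₀) Nset π
      (G.contMDiff_memberU hu₀.1.1) (G.contMDiff_memberV hu₀ hb₀ hJstd')
      (fun z hz => G.memberV_eq_memberU_inv hz) (G.isJHolomorphic_memberU hu₀)
      (G.isJHolomorphic_memberV hu₀ hb₀ hJstd') (G.injective_memberU hu₀.2.1)
      (G.injective_mfderiv_memberU hu₀) (G.injective_mfderiv_memberV hu₀ hb₀ hJstd' 0)
      (G.memberV_zero_notMem_range hb₀) hNo hNsub hπs hπsurj hzero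
  -- the members read off from the leaves (Stage D)
  obtain ⟨δ', Floc, hδ', hF0, hmem, hsmooth, himm, ⟨rI, hrI, hstd, hfam⟩, -⟩ :=
    G.exists_leafFloc J hJstd' hu₀ hb₀ hε hU0 hV0 hleaf hUfam hVfam hinj
  exact ⟨δ', hδ', Floc, hF0, hmem, hsmooth, himm, rI, hrI, hstd, hfam⟩

end Literature.Geometry.Symplectic
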